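import Literature.MathematicalPhysics.QuantumFieldTheory.Balaban1983to89.Node00.TorusCoverLevels
import Literature.MathematicalPhysics.QuantumFieldTheory.Balaban1983to89.B7Prop4Flat
import Literature.MathematicalPhysics.QuantumFieldTheory.Balaban1983to89.LatticeFieldCalculus
import HarnessLib

/-!
# Line H (`BirthV10.stub_halvingStep`, stmt-QuantumFields-19200) — LEMMA B-al, dictionary of (B-al-1) at a GENERAL level `j`: ★★ THE `ℤᵈ` STRAIGHT-LINE AVERAGE
# `linQ` OF A FIELD READ THROUGH `coverAt j` IS `L·bondAvg` ON THE TORUS AT THE COARSE BOND `⟨coverAt (j+1) z, κ⟩`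

Cell `ym3-torus` (HUMAN RULING D-0037: YM₃ on T³ is ladder rung R3 — NOT d = 4, NOT infinite volume, NOT a mass gap, NOT the Clay problem), width seat `ym-ust-19200-w3` gen 10
(LEAD-H ★w5-19200 g7 WORD 10 (2): LEMMA B-al ≡ (N1); SIGNATURE memo 67606d20 §2 (B-al-1), brick P3).  `--supports stmt-QuantumFields-19200 --as helper`; THEOREMS ONLY
(0 `def`, 0 `sorry`); count-neutral; nothing here claims B-al, `H42topCrossT`, (M2′), the stub, the crux or the gap.

WHY.  (B-al-1) compares ONE step of the `ℤᵈ` flat double bar ([Balaban1985Averaging] (89), lit `B7Prop3Flat.dbavg`; first order `linQ`, lit ✓`B7Prop4Flat.prop4_flat` k = 1)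
with one step of the torus double bar (✓`Prop8ChartDoubleBar.dbarAvgU`; first order `L·bondAvg`, ✓`HalvingDbarStraightMean.norm_mlog_dbarAvgU_sub_smul_bondAvg_le`) at EVERY
level `j → j+1` of the tower (the induction (B-al-2) runs level by level in LOCAL gauges).  ✓`P1FlatCoreTopBondDictionary` identifies the two first-order terms from the FINEST
level only (`cover = coverAt 0`, `k`-fold `bondAvgIter`).  THIS FILE is the one-step dictionary at a general level `j` (standing range `j + 1 ≤ m + K`), in the block-ALIGNED
frame of [Balaban1987RG1] (0.1) (lit ✓`Node00.blockOf_coverAt`∕`emb_coverAt`): the block sites of record of the coarse site `coverAt (j+1) z` are the covers of the corner box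
`L·z + [0,L)^d`, the straight runs lift, and the two plain means coincide term by term (no no-wrap hypothesis: both sides read the SAME torus bonds through the cover).
* §1 `blockSite_coverAt` (`Site.blockSite (coverAt (j+1) z) r = coverAt j (L·z + r)`), `runSite_coverAt`, `segSum_coverAt`;
* §2 ★★ `linQ_eq_smul_bondAvg_coverAt` — `linQ L B (L•z) κ = L • (bondAvg X)⟨coverAt (j+1) z, κ⟩` whenever `B w μ = X⟨coverAt j w, μ⟩` (matrix-valued fields).
HONEST SCOPE.  Bookkeeping over `Node00.TorusCoverLevels`, `TorusGeometry`, `LatticeFieldCalculus`, `B7Prop4Flat.linQ_eq_sum`; no estimate.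

References: T. Bałaban, CMP **98** (1985) 17–51 [Balaban1985Averaging] ((125) p.36); CMP **95** (1984) 17–40 [Balaban1984PropagatorsI] ((1.7), (1.11) pp.18–19);
CMP **116** (1988) [Balaban1987RG1] ((0.1) p.251).
-/

set_option autoImplicit false

noncomputable section

open scoped BigOperators Matrix.Norms.L2Operator

namespace Summit.QuantumFields.YangMills.Theorems.HalvingCombTubeDictionary

open Literature.MathematicalPhysics.QuantumFieldTheory.Balaban1983to89
open T4Continuum LatticeFieldCalculus
open B14DomainGeom (Pt)
open Node00 (coverAt coverAt_apply)
open B7Prop1Explicit (e e_apply boxVec)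
open B7Prop3Flat (linQ)
open B7Prop4Flat (linQ_eq_sum)

variable {P : Params} {j : ℕ}

/-! ## §1 Block sites and straight runs under `coverAt j` -/

/-- **The block sites of record of a covered coarse site are the covers of the corner box**: `Site.blockSite (π_{j+1} z) r = π_j (L·z + r)` (standing range) — [Balaban1987RG1]
(0.1)'s centred blocks have lowest label `L·z`, exactly lit `B7Prop1Explicit`'s corner block `L·z + [0,L)^d`. [cite: Balaban1987RG1, (0.1) p.251; Balaban1985Averaging, (42) p.23] -/
theorem blockSite_coverAt (hj : j + 1 ≤ P.m + P.K) (z : Pt P.d) (r : Fin P.d → Fin P.L) :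
    Site.blockSite (coverAt P (j + 1) z) r = coverAt P j ((P.L : ℤ) • z + boxVec P.L r) := by
  funext μ
  simp only [Site.blockSite, coverAt_apply, Pi.add_apply, Pi.smul_apply, smul_eq_mul, boxVec]
  rw [← Int.cast_natCast, ZMod.intCast_eq_intCast_iff_dvd_sub]
  refine ⟨z μ / (P.sitesPerDir (j + 1) : ℕ), ?_⟩
  push_cast
  rw [ZMod.val_intCast, P.sitesPerDir_eq_mul_succ hj]
  push_cast
  have h := Int.emod_add_mul_ediv (z μ) (P.sitesPerDir (j + 1) : ℕ)
  linear_combination (-(P.L : ℤ)) * h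

/-- `runSite (π_j w) μ t = π_j (w + t·e_μ)`: straight contours lift to the level-`j` cover. [cite: Balaban1984PropagatorsI, (1.7) p.18] -/
theorem runSite_coverAt (w : Pt P.d) (μ : Fin P.d) (t : ℕ) : runSite (coverAt P j w) μ t = coverAt P j (w + (t : ℤ) • e μ) := by
  funext ν
  simp only [runSite, Function.update_apply, coverAt_apply, Pi.add_apply, Pi.smul_apply, e_apply, smul_eq_mul]
  by_cases h : ν = μ
  · subst h; simp
  · simp [h]

variable {V : Type*} [AddCommGroup V] [Module ℝ V]

omit [Module ℝ V] in
/-- The straight-segment sum from a level-`j` covered site reads the field on the lifted bonds. [cite: Balaban1984PropagatorsI, (1.8) p.18] -/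
theorem segSum_coverAt (A : VecField P j V) (w : Pt P.d) (μ : Fin P.d) (n : ℕ) :
    segSum A (coverAt P j w) μ n = ∑ t ∈ Finset.range n, A ⟨coverAt P j (w + (t : ℤ) • e μ), μ⟩ := by
  unfold segSum
  refine Finset.sum_congr rfl fun t _ => ?_
  rw [runBond, runSite_coverAt]

/-! ## §2 The one-step dictionary `linQ ↔ L·bondAvg` at level `j` -/

variable {n : Type*} [Fintype n] [DecidableEq n]

/-- ★★ **THE ONE-STEP COMB∕TUBE DICTIONARY AT LEVEL `j`.**  For a `ℤᵈ` bond field `B` reading a level-`j` torus bond field `X` through the cover (`B w μ = X⟨π_j w, μ⟩`):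
`linQ L B (L•z) κ = L • (bondAvg X)⟨π_{j+1} z, κ⟩` — both are `L^{−d} Σ_{r ∈ [0,L)^d} Σ_{t<L} B(L·z + r + t·e_κ, κ)` ([Balaban1985Averaging] (125) at `V₀ = 1` vs
[Balaban1984PropagatorsI] (1.11)). [cite: Balaban1985Averaging, (125) p.36; Balaban1984PropagatorsI, (1.11) p.19; Balaban1987RG1, (0.1) p.251] -/
theorem linQ_eq_smul_bondAvg_coverAt (hj : j + 1 ≤ P.m + P.K) (X : PBond P j → Matrix n n ℂ) (B : Pt P.d → Fin P.d → Matrix n n ℂ)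
    (hBA : ∀ w μ, B w μ = X ⟨coverAt P j w, μ⟩) (z : Pt P.d) (κ : Fin P.d) :
    linQ P.L B ((P.L : ℤ) • z) κ = ((P.L : ℕ) : ℂ) • bondAvg X ⟨coverAt P (j + 1) z, κ⟩ := by
  have hL0 : (P.L : ℝ) ≠ 0 := by exact_mod_cast P.L_pos.ne'
  rw [linQ_eq_sum, bondAvg, Nat.cast_smul_eq_nsmul ℂ, ← Nat.cast_smul_eq_nsmul ℝ, smul_smul, Finset.smul_sum]
  refine Finset.sum_congr rfl fun r _ => ?_
  have hsite : Site.blockSite (⟨coverAt P (j + 1) z, κ⟩ : PBond P (j + 1)).src r = coverAt P j ((P.L : ℤ) • z + boxVec P.L r) :=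
    blockSite_coverAt hj z r
  rw [show (⟨coverAt P (j + 1) z, κ⟩ : PBond P (j + 1)).dir = κ from rfl, hsite, segSum_coverAt, Finset.sum_range fun t => X ⟨coverAt P j ((P.L : ℤ) • z + boxVec P.L r + (t : ℤ) • e κ), κ⟩]
  congr 1
  · rw [pow_succ, mul_inv, mul_comm ((P.L : ℝ) ^ P.d)⁻¹, ← mul_assoc, mul_inv_cancel₀ hL0, one_mul]
  · exact Finset.sum_congr rfl fun i _ => hBA _ _

end Summit.QuantumFields.YangMills.Theorems.HalvingCombTubeDictionary

end
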